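import Mathlib
import HarnessLib
import HarnessLib.Audit
import Summits.Langlands.Statement
import Literature.NumberTheory.GaloisRepresentations.ProjectiveType

/-!
Route: BianchiArtinPoints

CLOSED (retired) 2026-08-15T13:48:39Z by operator:999:1257524 — reason: not-a-thesis: assembly does not conclude the sub-problem Statement — note: D-0027 §2.1 audit (human 2026-08-15: routes that do not decide the summit are removed): the assembly concludes `StrongArtinEvenQ`, not the sub-problem statement; a NEW conforming route may be opened from the same idea (generated `closes : … → _root_.Langlands`).. The file is kept as the record of this route; refuted decls are indexed as negative knowledge (`ledger negatives`).

Route BianchiArtinPoints — realises idea card Langlands/Langlands/bianchi-artin-points ("Artin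
points in completed cohomology of CM fields: over ℚ(i) parity is gone").

THESIS X (it suffices to show X = X_K ∧ D).
X_K (decl StrongArtinEvenOverImQuad): for every irreducible EVEN two-dimensional Artin
representation ρ of G_ℚ (det ρ(c) = +1 at complex conjugation; written ℓ-adically as ρ : Γ_ℚ →ₜ*
GL₂(ℚ̄_p) with finite image, any prime p, any ι : ℚ̄_p ≃ ℂ) and every imaginary quadratic field K,
there is a cuspidal automorphic representation π_K of GL₂(𝔸_K) whose Satake parameters match
ρ|_{Γ_K} at almost every place — the summit's own predicate Summit.Langlands.SatakeFrobCompatibleAt,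
i.e. the n = 2, F = K, Hodge–Tate (0,0) sector of direction (B) GaloisToAutomorphic.
D (decl QuadraticDescentEven): automorphy of ρ|_{Γ_K} over the imaginary quadratic fields K descends
to ℚ.
Assembly (one line, proved in the planner's Sketch.lean): X_K → D → StrongArtinEvenQ, where
StrongArtinEvenQ := ∀ (p) [Fact p.Prime] (ι : PadicAlgCl p ≃+* ℂ) (ρ : FramedGaloisRep ℚ (PadicAlgCl
p) 2), Finite ρ.range → ρ irreducible → (∀ φ c, IsComplexConjugation φ c → det (ρ c) = 1) → ∃ (hcpt
: isCompact_glFiniteIntegralLevel 2 ℚ) (π : CuspidalAutomorphicRepData 2 ℚ hcpt), ∀ᶠ v in cofinite,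
Summit.Langlands.SatakeFrobCompatibleAt ι π.1 ρ v
(elaborates, Sketch.lean rc 0; every constant accepted:
Literature.NumberTheory.GaloisRepresentations.FramedGaloisRep, .IsComplexConjugation,
Literature.NumberTheory.Automorphic.isCompact_glFiniteIntegralLevel, .CuspidalAutomorphicRepData,
Summit.Langlands.SatakeFrobCompatibleAt). This is "π(ρ) exists" for every irreducible even ρ : G_ℚ →
GL₂(ℂ) — the sector of (B) over ℚ at non-regular weight in which not one icosahedral example is
known (Calegari2023 §12); solvable images are Langlands–Tunnell (tree: strongArtin_of_isSolvable),
so the open content is even icosahedral ρ, while every intermediate statement below is new already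
for solvable ρ.

MECHANISM for X_K (the card). Over K there is no complex conjugation, so ρ|_{Γ_K} is a candidate
ARTIN POINT of the completed cohomology of the Bianchi tower, whose big Hecke algebra 𝕋_K(K^p)
carries Galois determinants at every eigensystem, torsion included (Scholze2015). Layer 1 (informal
until the definitions CompletedCohomology / IsProModular land; ranks 2–3): OccurrenceArtinTorsion
O_K — every irreducible Artin ρ_K : Γ_K → GL₂(ℚ̄_p) is pro-modular of tame level K^p(𝔫(ρ_K)),
torsion limits allowed — and RealizationArtinWeight R_K — finite-image points of Spf 𝕋_K(K^p) are
classical cuspidal π of Artin type; O_K → R_K → X_K verbatim. O_K comes with the card's devissage: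
CM-dihedral points by CM families (a proof; Calegari–Mazur's "CM" case), solvable layers by
Treumann–Venkatesh Smith-theoretic DESCENT of occurrence at ℓ = layer degree (support
SmithDescentOccurrence), icosahedral points as a falsifiable numerical prediction (Bianchi torsion
Hecke eigensystems mod ℓ^m). Layer 1' (typed now; ranks 5–6): the characteristic-0 shadow
EvenRestrictionLimit (ρ|_{Γ_K} is a p-adic limit of Galois representations attached to
regular-algebraic cuspidal π_m of GL₂(𝔸_K), congruent mod p^m, tame level 𝔫(ρ)) and
LimitClassicality (a finite-image irreducible σ : Γ_K → GL₂(ℚ̄_p) that is such a limit is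
automorphic of Artin type), with the glue LimitChainGlue : EvenRestrictionLimit → LimitClassicality
→ X_K (support, provable now) and the theorem-sized dihedral case DihedralEvenRestrictionLimit
(support; CM families over the CM field LK). Calegari–Mazur (CalegariMazur2008 Cor. 1.4, under
Strong Leopoldt) confine classical nearly-ordinary approximation of ρ|_K at split p to the
anti-diagonal (non-classical) weight direction, so Layer 1' lives on non-ordinary/infinite-slope
approximants and Layer 1 (torsion) is the line's main bet — which is why O_K, not its shadow, is
rank 2.

Rationale: WHY THIS LINE. Over an imaginary quadratic K the parity invariant that keeps every even ρ : G_ℚ →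
GL₂(ℂ) off the Coleman–Mazur eigencurve, off 𝕋(K^p) of modular curves and off every
Hilbert/quaternionic eigenvariety (det ρ(c) = −1 is locally constant there) simply does not exist,
while Emerton's completed cohomology of the Bianchi tower carries Scholze determinants at every
Hecke eigensystem, torsion included [Scholze2015]. The card converts this into an occurrence
conjecture O_K plus a devissage — CM-dihedral points by CM families (= the "CM" case of
[CalegariMazur2008]), solvable layers by Smith theory at ℓ = layer degree [TreumannVenkatesh2016]
used in the DESCENDING direction — and a decisive cheap test (mod-ℓ sightings exist:
[Figueiredo1999], [Sengun2014Bianchi] §11.1; O_K is their ℓ-adic refinement). Imports: p-adic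
interpolation / completed cohomology (Emerton; [HansenUniversalEigenvarieties2017] Conj. 1.2.3),
ℤ/ℓ-equivariant algebraic topology (Smith theory, Brauer homomorphism of Hecke algebras), solvable
base change [ArthurClozelAMS120] for the final quadratic descent, and certified computation (Bianchi
torsion Hecke modules) as the refutation engine. We type today what the tree can hold — the
summit-facing frame over ℚ and K and the characteristic-0 shadow of O_K — and file O_K / R_K
informally with definition requests (CompletedCohomology, IsProModular).
RANKED CRUXES. r2 OccurrenceArtinTorsion (O_K; informal): every irreducible Artin ρ_K is pro-modular
in 𝕋_K(K^p), torsion limits allowed; codimension-one miracle (dim R = 4 > 3 = dim 𝕋,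
Calegari–Mazur/Calegari–Emerton) needing a structural reason; cheapest decisive test = Hecke
eigensystems on H^*(Γ₀(𝔫ℓ^s) ⊂ GL₂(ℤ[i]), ℤ/ℓ^m) for the even tetrahedral ρ of conductor 163². r3
RealizationArtinWeight (R_K; informal): finite-image points of Spf 𝕋_K are classical of Artin type —
the non-regular-weight wall over a field with a complex place ([AllenKhareThorne2021WeightOne] §1:
"one does not know how to go from weight 1 to weight 2 [over a CM field]"); first structural handle:
the locally analytic eigenspace has the singular Dospinescu–Paškūnas–Schraen infinitesimal character
(arXiv:2605.03519, 2026). r4 QuadraticDescentEven (typed): automorphy of ρ|_K for the imaginary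
quadratic K descends to ℚ; one K never suffices (π vs π ⊗ χ_K at inert p; a weight-one descendant
with central character det ρ·χ_K must be excluded, invisible in the a.e. model); proposed proof =
central-character dichotomy + [DeligneSerreASENS1974] + parity, sign coherence at inert p from ≥ 3
fields by Chebotarev in the A₅ × multiquadratic field, rigidity at every unramified place
([Gelbart1997] Prop. 4.1); [MartinRamakrishnan2016] Thm A covers only density-zero disagreement
(degree-one primes of the TOP field). r5 EvenRestrictionLimit (typed; Calegari–Mazur's exceptional
case (3)): ρ|_K is a p-adic limit (congruences mod p^m, tame level 𝔫(ρ)) of Galois representations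
attached to regular-algebraic cuspidal π_m of GL₂(𝔸_K); TRUE for dihedral ρ (support
DihedralEvenRestrictionLimit, provable now: algebraic Hecke characters of the CM field LK
approximate ψ), obstructed in the nearly-ordinary locus at split p by [CalegariMazur2008] Cor. 1.4
under Strong Leopoldt, open through non-ordinary / infinite-slope approximants and at inert p. r6
LimitClassicality (typed special case of R_K with classical char-0 input). Support: LimitChainGlue
(r5 → r6 → X_K, provable now), Assembly (proved in Sketch.lean), SmithDescentOccurrence (informal
calibration of O_K's devissage).
KILL CRITERIA. (k1) Certified Bianchi computation: eigensystem of ρ|_{ℚ(i)} (ρ even tetrahedral, N =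
163², or the smallest even octahedral) present mod ℓ but ABSENT mod ℓ² at every level ℓ^s, s ≤ 2,
for ℓ ∈ {2, 3} and one split ℓ ⇒ O_K refuted already for a solvable ρ ⇒ close the route (receptacle
idea dead). (k2) A Calegari–Mazur-type isolation theorem for ρ|_K valid for every refinement and
slope refutes r5 ⇒ drop r5/r6 (not load-bearing; torsion line O_K stands) and restate O_K typed once
CompletedCohomology lands. (k3) A provably non-classical finite-image point of Spf 𝕋_K (r3/r6
refuted) kills the line outright. (k4) r4 refuted inside the a.e. RepData model ⇒ restate with
conductor / archimedean data (model repair, not a kill); r4 refuted mathematically would contradict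
functoriality itself.
NOT DECOMPOSED YET. Local–global compatibility at ramified places and IsLAlgebraic of π(ρ) (the
LocalGlobalCompatibleAt half of Corresponds; local converse theorem for GL₂); the general
(non-base-change, non-even) icosahedral ρ_K over K, reached by O_K → R_K verbatim and filed when
typed; Smith descent and CM-dihedral occurrence as typed statements (need CompletedCohomology);
inert/ramified-p and p = 2 refinements of r5; the odd sector (Khare–Wintenberger, known).

Novelty: NEAREST PRIOR ART (searched 2026-08-15: lit search zbmath/crossref "Martin Ramakrishnan Artin
L-series degree one primes" → doi:10.1090/conm/664/13038 = arXiv:1502.04175, read Thm A p.2; lit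
read arXiv:0708.2451 (CalegariMazur2008) pp.1–3: Thm 1.2, Conj. 1.3, Cor. 1.4, §8 Thm 8.1 via the
card's audit; lit frontier Langlands --since 2020 → arXiv:2605.03519 read pp.2–3; card's own
searches: doi:10.1023/a:1001739825854 (Figueiredo1999), arXiv:1204.6697 §11.1 (Sengun2014Bianchi),
arXiv:1412.1533 Conj. 1.2.3 (HansenUniversalEigenvarieties2017), arXiv:1407.2346
(TreumannVenkatesh2016), arXiv:1306.2070 (Scholze2015), arXiv:1910.12986 §1
(AllenKhareThorne2021WeightOne); lean search: StrongArtinGL2 / TunnellOctahedralGlobal /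
ProjectiveType vocabulary, no completed-cohomology or Bianchi notion in the tree). (1)
CalegariMazur2008 already single out even representations descending to ℚ as the third exceptional
locus where infinitesimally classical deformations over an imaginary quadratic K may exist, contain
the CM-dihedral families, and prove (Cor. 1.4 / Thm 8.1, under Strong Leopoldt) that such
deformations of ρ|_K for even non-dihedral ρ have ANTI-diagonal weight only. (2) Figueiredo1999 and
Sengun2014Bianchi §11.1 observed restrictions of even ρ mod ℓ as torsion Bianchi classes that do not
lift. (3) HansenUniversalEigenvarieties2017 Conj. 1.2.3 states pro-modularity "iff trianguline" for
general F. (4) MartinRamakrishnan2016 Thm A: agreement at degree-one primes of the top field of  [refs: 10.1090/conm/664/13038, 10.1023/a:1001739825854, 1502.04175, 0708.2451, 2605.03519, 1204.6697, 1412.1533, 1407.2346, 1306.2070, 1910.12986, doi:10.1090/conm/664/13038, doi:10.1023/a, CalegariMazur2008, Figueiredo1999, HansenUniversalEigenvarieties2017, TreumannVenkatesh2016, Scholze2015, MartinRamakrishnan2016]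

Barriers (technique_class: completed-cohomology p-adic-interpolation congruences): technique_class: completed-cohomology p-adic-interpolation congruences
- Literature.Barriers.Langlands.NonRegularWeightBarrier: APPLIES to r3 RealizationArtinWeight and r6
LimitClassicality verbatim (weight (0,0) at the complex place is not IsRegular; no classicality
mechanism is claimed — these items ARE the wall, isolated and typed); EVADED for occurrence (r2,
r5): completed cohomology / congruence limits need no regular weight, and
DihedralEvenRestrictionLimit shows Artin-weight points genuinely arise as limits of regular CM
points.
- Literature.Barriers.Langlands.ShimuraVarietyRealizationBarrier: not engaged for K imaginary
quadratic (CM): Scholze's determinants on Bianchi completed/torsion cohomology come from the U(2,2)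
boundary and are used as a theorem [Scholze2015]; no variety realising ρ|_K is sought (none can:
Artin weight at a complex place is non-cohomological).
- Literature.Barriers.Langlands.ModPLanglandsGL2BeyondQp: not engaged — no p-adic or mod-p local
Langlands correspondence for GL₂(K_v) is invoked by any item; occurrence is global (CM families,
Smith theory, congruences), realization is posed as a statement, not derived from a local
correspondence; for K = ℚ(i) and p split, GL₂(K_v) = GL₂(ℚ_p) anyway.
- Literature.Barriers.Langlands.ModPLanglandsGL2BeyondQpFpBar: same — nothing in the route
classifies or uses mod-p representations of GL₂(F), F ≠ ℚ_p.
- Literature.Barriers.Langlands.BreuilPaskunas2012_supersingularFamily: same — the abundance of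
supersingu

History (route lifecycle, newest last):
- 2026-08-15T13:48:39Z · CLOSED retired — not-a-thesis: assembly does not conclude the sub-problem Statement (operator:999:1257524)

sub-problem: Langlands · status: closed(retired) · opened planner-plancard-Langlands-Langlands-bianchi--06629191-0 2026-08-15T11:03:04Z · rev 2 · ledger route-Langlands-BianchiArtinPoints
GENERATED by the gate from the ledger (D-0016/17). Provers cite these decls: `theorem foo : Summit.Langlands.Langlands.Theses.BianchiArtinPoints.<Decl> := …` in Summits/Langlands/Langlands/Theorems/<Name>.lean.
-/

namespace Summit.Langlands.Langlands.Theses.BianchiArtinPoints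

open scoped BigOperators Topology Manifold Classical MeasureTheory ProbabilityTheory Matrix InnerProductSpace ComplexConjugate ContinuousMap
open Filter Set Function TopologicalSpace MeasureTheory

attribute [summit_statement] _root_.Langlands

/-- item stmt-Langlands-2303 · target · rank 0 · closed · moot by None · by planner
why it might fail: Open with no known even icosahedral example; false only if GL₂ functoriality over ℚ fails. As typed only the a.e. Satake half, in the summit's own normalisation (Satake class = geometric Frobenius via ι), so no normalisation loophole beyond the audited Statement.
sources: Calegari2023, §12, BuzzardEtAl2001, Introduction, BuzzardGeeLMS2014, Conj. 3.2.2, Literature.NumberTheory.Automorphic.strongArtin_of_isSolvable (tree: solvable images, any parity)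
[target] π(ρ) exists for every irreducible EVEN ρ : G_ℚ → GL₂ with finite image: a cuspidal
automorphic representation π of GL₂(𝔸_ℚ) (a Maass form of eigenvalue 1/4) with
Summit.Langlands.SatakeFrobCompatibleAt ι π ρ v for almost all v — the Satake half of
GaloisToAutomorphic for n = 2, F = ℚ, Hodge–Tate weights (0,0), even parity (det ρ(c) = +1 for every
complex conjugation c, typed with IsComplexConjugation). Solvable projective image (D_m, A₄, S₄) is
Langlands–Tunnell for either parity (tree: strongArtin_of_isSolvable), so the open content is
projective image A₅, where not one example is known (Calegari2023 §12). NOT included (not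
decomposed): IsLAlgebraic of π and LocalGlobalCompatibleAt at ramified places. -/
@[route_item "route-Langlands-BianchiArtinPoints"]
def StrongArtinEvenQ : Prop :=
  ∀ (p : ℕ) [Fact p.Prime] (ι : PadicAlgCl p ≃+* ℂ) (ρ : Literature.NumberTheory.GaloisRepresentations.FramedGaloisRep ℚ (PadicAlgCl p) 2), Finite ρ.toMonoidHom.range → ρ.toGaloisRep.IsIrreducible → (∀ (φ : ℚ →+* ℝ) (c : Field.absoluteGaloisGroup ℚ), Literature.NumberTheory.GaloisRepresentations.IsComplexConjugation φ c → Matrix.GeneralLinearGroup.det (ρ c) = 1) → ∃ (hcpt : Literature.NumberTheory.Automorphic.isCompact_glFiniteIntegralLevel 2 ℚ) (π : Literature.NumberTheory.Automorphic.CuspidalAutomorphicRepData 2 ℚ hcpt), ∀ᶠ v : IsDedekindDomain.HeightOneSpectrum (NumberField.RingOfIntegers ℚ) in Filter.cofinite, Summit.Langlands.SatakeFrobCompatibleAt ι π.1 ρ v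

-- item stmt-Langlands-2438 · crux · rank 2 · closed · moot by None · by planner — informal only, no Lean statement yet:
--   [crux] O_K — the card's OCCURRENCE conjecture, torsion allowed (rank 2; informal until the
--   definitions CompletedCohomology / IsProModular land, then restated typed by tenure). K imaginary
--   quadratic, p any prime, ρ_K : Γ_K → GL₂(ℚ̄_p) continuous, absolutely irreducible, FINITE image
--   (Artin), tame conductor 𝔫 prime to p. Let 𝕋_K(K^p) := lim_{s,t} (image of the spherical Hecke
--   algebra in End H^*(Y(K^pK_p(p^s)), ℤ/p^t)) be the big Hecke algebra of Emerton's completed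
--   cohomology of the Bianchi tower of tame level K^p = K₁(𝔫) (operators T_v, S_v, v ∤ 𝔫p). CLAIM: the
--   eigensystem v ↦ (tr ρ_K(Frob_v),

-- item stmt-Langlands-2456 · crux · rank 3 · closed · moot by None · by planner — informal only, no Lean statement yet:
--   [support → crux when typed] R_K — REALIZATION / classicality at Artin weight over K (the card's R4;
--   rank 3; the wall; informal until CompletedCohomology lands — its typed special case with classical
--   characteristic-0 input is the crux LimitClassicality). K imaginary quadratic, p prime, ι : ℚ̄_p ≃ ℂ,
--   x : 𝕋_K(K^p) → ℚ̄_p a point of the big Hecke algebra of completed cohomology of the Bianchi tower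
--   (tame level K^p) whose Scholze determinant D_x is absolutely irreducible with FINITE image
--   (equivalently: de Rham with Hodge–Tate weights (0,0) at the places over p and finite-order
--   determinant). CLAIM:

/-- item stmt-Langlands-2306 · crux · rank 4 · closed · moot by None · by planner
why it might fail: One K fixes the descended π only up to ⊗χ_K and may give a weight-one form with central character det ρ·χ_K, invisible in the a.e. RepData model (no archimedean parameter); sign coherence at inert p needs ≥ 3 fields plus rigidity at every unramified place, not in the tree.
sources: ArthurClozelAMS120, Ch. 3 Thm 3.1 and Thm 4.2 (d), Tunnell1981, Lemma p. 174 (prototype: two base changes of coprime type), Gelbart1997, Prop. 4.1 (a.e. ⇒ every unramified place), DeligneSerreASENS1974, Thm 4.1, MartinRamakrishnan2016 = arXiv:1502.04175, Thm A (read p.2: density-zero disagreement only), Literature.NumberTheory.Automorphic.cuspidal_descent_cyclic and .exists_twist_quadraticSign (tree, RepData model)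
[crux] Descent ℚ ← K for even ρ: if for every imaginary quadratic K (with ρ|_K irreducible) some
cuspidal π_K on GL₂(𝔸_K) is Satake-compatible with ρ|_K a.e., then some cuspidal π on GL₂(𝔸_ℚ) is
Satake-compatible with ρ a.e. Proposed proof: (1) π_K has Gal(K/ℚ)-stable Satake data
(IsGaloisStableSatakeAE) ⇒ descends (cuspidal_descent_cyclic = Arthur–Clozel Thm 4.2(d), RepData
model) to π^K with BC(π^K) = π_K weakly; (2) at split p, t(π^K_p) ∼ ρ(Frob_p); at inert p only t² ∼
ρ(Frob_p)² and ω_{π^K} = det ρ · χ_K^e, e ∈ {0,1}; e = 1 would make π^K a weight-one form (ω_∞(−1) =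
−1) whose Deligne–Serre representation ρ' satisfies ρ'|_K ≅ ρ|_K, hence ρ' ≅ ρ ⊗ ψ (trivial
centraliser of A₄/S₄/A₅ in PGL₂), contradicting parity — the a.e. RepData model has no archimedean
parameter, so this step needs a finite-place substitute or an imported fact; (3) with e = 0,
t(π^K_p) ∼ ε_p ρ(Frob_p), ε_p = ±1 at inert p; comparing the descents from K and K' (Arthur–Clozel
Thm 3.1 over K and over KK') gives π^{K'} ≅ π^K ⊗ χ, χ ∈ {1, χ_K, χ_{K'}, χ_Kχ_{K'}}, so ε is
constant on {p inert in K, split in K', tr ρ(Frob_p) ≠ 0}; three auxiliary fields plus Chebotarev in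
the compositum of the A₅-field with the mul -/
@[route_item "route-Langlands-BianchiArtinPoints"]
def QuadraticDescentEven : Prop :=
  ∀ (p : ℕ) [Fact p.Prime] (ι : PadicAlgCl p ≃+* ℂ) (ρ : Literature.NumberTheory.GaloisRepresentations.FramedGaloisRep ℚ (PadicAlgCl p) 2), Finite ρ.toMonoidHom.range → ρ.toGaloisRep.IsIrreducible → (∀ (φ : ℚ →+* ℝ) (c : Field.absoluteGaloisGroup ℚ), Literature.NumberTheory.GaloisRepresentations.IsComplexConjugation φ c → Matrix.GeneralLinearGroup.det (ρ c) = 1) → (∀ (K : Type) [Field K] [NumberField K], NumberField.IsTotallyComplex K → Module.finrank ℚ K = 2 → (ρ.restrictField K).toGaloisRep.IsIrreducible → ∃ (hcpt : Literature.NumberTheory.Automorphic.isCompact_glFiniteIntegralLevel 2 K) (π : Literature.NumberTheory.Automorphic.CuspidalAutomorphicRepData 2 K hcpt), ∀ᶠ w : IsDedekindDomain.HeightOneSpectrum (NumberField.RingOfIntegers K) in Filter.cofinite, Summit.Langlands.SatakeFrobCompatibleAt ι π.1 (ρ.restrictField K) w) → ∃ (hcpt : Literature.NumberTheory.Automorphic.isCompact_glFiniteIntegralLevel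 2 ℚ) (π : Literature.NumberTheory.Automorphic.CuspidalAutomorphicRepData 2 ℚ hcpt), ∀ᶠ v : IsDedekindDomain.HeightOneSpectrum (NumberField.RingOfIntegers ℚ) in Filter.cofinite, Summit.Langlands.SatakeFrobCompatibleAt ι π.1 ρ v

/-- item stmt-Langlands-2307 · crux · rank 5 · closed · moot by None · by planner
why it might fail: Calegari–Mazur Cor. 1.4 (Strong Leopoldt, p split, non-dihedral image): infinitesimally classical n.o. deformations of ρ|_K have anti-diagonal weight only, so nearly-ordinary cohomological approximants cannot accumulate at ρ|_K; only non-ordinary/infinite-slope witnesses or torsion (O_K) remain.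
sources: CalegariMazur2008 = arXiv:0708.2451, Thm 1.2, Conj. 1.3, Cor. 1.4 (read pp.2-3), Thm 8.1, HansenUniversalEigenvarieties2017 = arXiv:1412.1533, Conj. 1.2.3 and Def. 1.2.1, Sengun2014Bianchi = arXiv:1204.6697, §11.1 (163-tetrahedral class mod 163, not lifting), Figueiredo1999 (doi:10.1023/a:1001739825854), Literature.NumberTheory.Automorphic.exists_galoisRep_of_regularAlgebraic (tree, lang.S27: normalisation of r_m)
[crux] Characteristic-0 occurrence for even restrictions (Calegari–Mazur's exceptional case (3)): ρ
even irreducible of finite image over ℚ, K imaginary quadratic with ρ|_K irreducible, any p, ι; for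
every m there are a REGULAR-ALGEBRAIC (cohomological) cuspidal π_m of GL₂(𝔸_K), unramified wherever
ρ|_K is unramified away from p (tame level 𝔫(ρ)), and r_m : Γ_K → GL₂(ℚ̄_p) attached to π_m in the
lang.S27 normalisation (arithFrobPolyOfSatake ι q_v 2 α at a.e. v, exactly as in
exists_galoisRep_of_regularAlgebraic) with r_m ≡ ρ|_K mod p^m entrywise (norm of PadicAlgCl p;
frames are free since r_m is existential). Content: the Frobenius traces of ρ|_K are p-adic limits
of Hecke eigenvalues of cohomological Bianchi cusp forms of p-power level. TRUE for dihedral ρ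
(support DihedralEvenRestrictionLimit: CM families over the CM field LK). For A₄/S₄/A₅ images,
Calegari–Mazur Cor. 1.4 (Strong Leopoldt, p split) forbids accumulation of NEARLY-ORDINARY classical
points at ρ|_K (their infinitesimal weights would be diagonal = parallel, while only anti-diagonal
ones exist), so witnesses must be non-ordinary at a place above p or of infinite slope, or p
inert/ramified. Implies O_K-occurrence at p -/
@[route_item "route-Langlands-BianchiArtinPoints"]
def EvenRestrictionLimit : Prop :=
  ∀ (p : ℕ) [Fact p.Prime] (ι : PadicAlgCl p ≃+* ℂ) (ρ : Literature.NumberTheory.GaloisRepresentations.FramedGaloisRep ℚ (PadicAlgCl p) 2), Finite ρ.toMonoidHom.range → ρ.toGaloisRep.IsIrreducible → (∀ (φ : ℚ →+* ℝ) (c : Field.absoluteGaloisGroup ℚ), Literature.NumberTheory.GaloisRepresentations.IsComplexConjugation φ c → Matrix.GeneralLinearGroup.det (ρ c) = 1) → ∀ (K : Type) [Field K] [NumberField K], NumberField.IsTotallyComplex K → Module.finrank ℚ K = 2 → (ρ.restrictField K).toGaloisRep.IsIrreducible → ∀ m : ℕ, ∃ (hcpt : Literature.NumberTheory.Automorphic.isCompact_glFiniteIntegralLevel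 2 K) (π : Literature.NumberTheory.Automorphic.CuspidalAutomorphicRepData 2 K hcpt) (r : Literature.NumberTheory.GaloisRepresentations.FramedGaloisRep K (PadicAlgCl p) 2), π.1.IsRegularAlgebraic ∧ (∀ v : IsDedekindDomain.HeightOneSpectrum (NumberField.RingOfIntegers K), (ρ.restrictField K).IsUnramifiedAt v → ((p : ℕ) : NumberField.RingOfIntegers K) ∉ v.asIdeal → π.1.IsUnramifiedAt v) ∧ (∀ᶠ v : IsDedekindDomain.HeightOneSpectrum (NumberField.RingOfIntegers K) in Filter.cofinite, ∀ α : Multiset ℂ, π.1.HasSatakeParamAt v α → r.IsUnramifiedAt v ∧ r.HasFrobCharpolyAt v (Literature.NumberTheory.Automorphic.arithFrobPolyOfSatake ι v.residueCard 2 α)) ∧ (∀ (g : Field.absoluteGaloisGroup K) (i j : Fin 2), ‖(r g).val i j - ((ρ.restrictField K) g).val i j‖ ≤ (p : ℝ) ^ (-(m : ℤ)))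

/-- item stmt-Langlands-2308 · crux · rank 6 · closed · moot by None · by planner
why it might fail: The non-regular-weight wall over a field with a complex place: no Shimura variety, no q-expansion or analytic-continuation gluing à la Buzzard–Taylor, no p-adic local–global compatibility at singular weight; even algebraicity of weight-0 Bianchi Hecke eigenvalues is open.
sources: Literature.Barriers.Langlands.NonRegularWeightBarrier (tree), AllenKhareThorne2021WeightOne = arXiv:1910.12986, §1 (weight 1 → weight 2 over CM fields unknown), Calegari2023, §12, arXiv:2605.03519, Abstract and §1 (DPS infinitesimal characters, GL_n over CM fields), Buzzard–Taylor, Companion forms and weight one forms, Ann. of Math. 149 (1999) 905–919 (the ℚ-precedent), HansenUniversalEigenvarieties2017, Thm 1.1.2–1.1.3 (eigenvarieties for Res GL₂)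
[crux] Limit classicality at Artin weight over an imaginary quadratic K (typed special case of R_K):
if σ : Γ_K → GL₂(ℚ̄_p) has finite image, is irreducible, and is for every m congruent mod p^m to a
Galois representation r_m attached (lang.S27 normalisation, a.e. places) to a regular-algebraic
cuspidal π_m of GL₂(𝔸_K) of tame level 𝔫(σ), then some cuspidal π of GL₂(𝔸_K) is Satake-compatible
with σ at almost all places (Summit.Langlands.SatakeFrobCompatibleAt; π is then of Artin type,
weight 0 at the complex place). Over ℚ the analogue (p-adic limits of classical forms at a
weight-one point are classical) is Buzzard–Taylor / Khare–Wintenberger; over K nothing is known: no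
Shimura variety, no q-expansion gluing, π_{m,∞} cohomological of growing weight while π_∞ must be
the weight-0 principal series. Handles: eigenvariety geometry of Res_{K/ℚ}GL₂ (Hansen), the
infinitesimal character of the locally analytic σ-eigenspace of completed cohomology
(Dospinescu–Paškūnas–Schraen; proved over CM fields in the decomposed-generic case,
arXiv:2605.03519), Rankin–Selberg continuation against the π_m. This item IS the non-regular-weight
wall for this receptacle, filed to be attacked, refined by r -/
@[route_item "route-Langlands-BianchiArtinPoints"]
def LimitClassicality : Prop :=
  ∀ (K : Type) [Field K] [NumberField K], NumberField.IsTotallyComplex K → Module.finrank ℚ K = 2 → ∀ (p : ℕ) [Fact p.Prime] (ι : PadicAlgCl p ≃+* ℂ) (σ : Literature.NumberTheory.GaloisRepresentations.FramedGaloisRep K (PadicAlgCl p) 2), Finite σ.toMonoidHom.range → σ.toGaloisRep.IsIrreducible → (∀ m : ℕ, ∃ (hcpt : Literature.NumberTheory.Automorphic.isCompact_glFiniteIntegralLevel 2 K) (π : Literature.NumberTheory.Automorphic.CuspidalAutomorphicRepData 2 K hcpt) (r : Literature.NumberTheory.GaloisRepresentations.FramedGaloisRep K (PadicAlgCl p)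 2), π.1.IsRegularAlgebraic ∧ (∀ v : IsDedekindDomain.HeightOneSpectrum (NumberField.RingOfIntegers K), σ.IsUnramifiedAt v → ((p : ℕ) : NumberField.RingOfIntegers K) ∉ v.asIdeal → π.1.IsUnramifiedAt v) ∧ (∀ᶠ v : IsDedekindDomain.HeightOneSpectrum (NumberField.RingOfIntegers K) in Filter.cofinite, ∀ α : Multiset ℂ, π.1.HasSatakeParamAt v α → r.IsUnramifiedAt v ∧ r.HasFrobCharpolyAt v (Literature.NumberTheory.Automorphic.arithFrobPolyOfSatake ι v.residueCard 2 α)) ∧ (∀ (g : Field.absoluteGaloisGroup K) (i j : Fin 2), ‖(r g).val i j - (σ g).val i j‖ ≤ (p : ℝ) ^ (-(m : ℤ)))) → ∃ (hcpt : Literature.NumberTheory.Automorphic.isCompact_glFiniteIntegralLevel 2 K) (π : Literature.NumberTheory.Automorphic.CuspidalAutomorphicRepData 2 K hcpt), ∀ᶠ w : IsDedekindDomain.HeightOneSpectrum (NumberField.RingOfIntegers K) in Filter.cofinite, Summit.Langlands.SatakeFrobCompatibleAt ι π.1 σ w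

/-- item stmt-Langlands-2305 · target · rank 7 · closed · moot by None · by planner
why it might fail: Equivalent (given quadratic base change) to even strong Artin over ℚ one field up; no non-solvable instance known; the typed a.e. Satake form inherits the summit's normalisation.
sources: CalegariMazur2008 = arXiv:0708.2451, §1 and §8 (even representations over imaginary quadratic K), Literature.NumberTheory.Automorphic.strongArtin_of_isSolvable (tree), Calegari2023, §12
[target] X_K, the K-sector: for ρ even irreducible with finite image over ℚ and K imaginary
quadratic (K : Type, NumberField, NumberField.IsTotallyComplex, finrank ℚ K = 2) with ρ|_{Γ_K}
irreducible (automatic: an irreducible ρ that becomes reducible on Γ_K is induced from K, hence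
odd), a cuspidal π_K on GL₂(𝔸_K) Satake-compatible with ρ.restrictField K at almost all places. This
is direction (B) of the summit at F = K, n = 2 for these finite-image ρ_K. Such ρ|_K is never the
base change of an odd (automorphic) representation — parity is twist-invariant and A₄/S₄/A₅ have
trivial centraliser in PGL₂ — so nothing beyond solvable images is known. Reached two ways: O_K →
R_K (informal torsion layer, ranks 2–3) and EvenRestrictionLimit → LimitClassicality (typed, glue =
support LimitChainGlue). -/
@[route_item "route-Langlands-BianchiArtinPoints"]
def StrongArtinEvenOverImQuad : Prop :=
  ∀ (p : ℕ) [Fact p.Prime] (ι : PadicAlgCl p ≃+* ℂ) (ρ : Literature.NumberTheory.GaloisRepresentations.FramedGaloisRep ℚ (PadicAlgCl p) 2), Finite ρ.toMonoidHom.range → ρ.toGaloisRep.IsIrreducible → (∀ (φ : ℚ →+* ℝ) (c : Field.absoluteGaloisGroup ℚ), Literature.NumberTheory.GaloisRepresentations.IsComplexConjugation φ c → Matrix.GeneralLinearGroup.det (ρ c) = 1) → ∀ (K : Type) [Field K] [NumberField K], NumberField.IsTotallyComplex K → Module.finrank ℚ K = 2 → (ρ.restrictField K).toGaloisRep.IsIrreducible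 → ∃ (hcpt : Literature.NumberTheory.Automorphic.isCompact_glFiniteIntegralLevel 2 K) (π : Literature.NumberTheory.Automorphic.CuspidalAutomorphicRepData 2 K hcpt), ∀ᶠ w : IsDedekindDomain.HeightOneSpectrum (NumberField.RingOfIntegers K) in Filter.cofinite, Summit.Langlands.SatakeFrobCompatibleAt ι π.1 (ρ.restrictField K) w

/-- item stmt-Langlands-2309 · support · rank 9 · closed · moot by None · by planner
sources: planner Sketch.lean (rc 0)
[support] Glue EvenRestrictionLimit → LimitClassicality → StrongArtinEvenOverImQuad: apply
LimitClassicality to σ := ρ.restrictField K (finite image inherited by restriction — range of ρ ∘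
absGaloisRestrict ≤ range of ρ; irreducibility is the hypothesis) with the approximants supplied by
EvenRestrictionLimit. Provable now (bookkeeping; the one lemma is Finite (ρ.restrictField
K).toMonoidHom.range from Finite ρ.toMonoidHom.range). -/
@[route_item "route-Langlands-BianchiArtinPoints"]
def LimitChainGlue : Prop :=
  EvenRestrictionLimit → LimitClassicality → StrongArtinEvenOverImQuad

/-- item stmt-Langlands-2310 · support · rank 9 · closed · moot by None · by planner
sources: CalegariMazur2008, Thm 1.2 ('CM' case) and §1, Literature.NumberTheory.Automorphic.automorphicInduction_character (tree, named fact AI of a Hecke character), JacquetLanglands1970, §12 (dihedral forms), card Summits/Langlands/Langlands/Ideas/bianchi-artin-points.md §Mechanism R1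
[support] R1 of the card, theorem-sized: EvenRestrictionLimit under the extra hypothesis
IsDihedralType ρ.toMonoidHom (projective image D_m, m ≥ 2). Sketch: ρ ≅ Ind_L^ℚ ψ with L REAL
quadratic (ρ is even), so ρ|_K ≅ Ind_{L'}^{K} ψ' with L' = LK a CM quartic field (maximal totally
real subfield L); the finite-order Hecke character ψ' of L' is a p-adic limit of ALGEBRAIC Hecke
characters ψ'λ_m of L' with infinity types non-parallel at the two places of L' above each complex
place of K and exponents ≡ 0 mod (p−1)p^{m−1} (they exist exactly because L' is CM: Weil type-A₀
characters; 1 + r₂(L') = 3 independent ℤ_p-directions, no Leopoldt input); π_m := AI_{L'/K}(ψ'λ_m)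
is cuspidal (ψ'λ_m not Gal(L'/K)-invariant) and regular algebraic of p-power level times 𝔫(ρ|_K);
r_m := Ind of the p-adic avatar of ψ'λ_m (class field theory; no HLTT needed) is compatible with π_m
in the lang.S27 normalisation and ≡ ρ|_K mod p^m. This is Calegari–Mazur's 'CM' exceptional case; it
calibrates every predicate of r5 (normalisation, tame level, congruence) and is the first theorem
the route should land. Tree vocabulary: Literature AutomorphicInductionCharacter
(automorphicInduction_character), HeckeCharacter -/
@[route_item "route-Langlands-BianchiArtinPoints"]
def DihedralEvenRestrictionLimit : Prop :=
  ∀ (p : ℕ) [Fact p.Prime] (ι : PadicAlgCl p ≃+* ℂ) (ρ : Literature.NumberTheory.GaloisRepresentations.FramedGaloisRep ℚ (PadicAlgCl p) 2), Finite ρ.toMonoidHom.range → ρ.toGaloisRep.IsIrreducible → Literature.NumberTheory.GaloisRepresentations.IsDihedralType ρ.toMonoidHom → (∀ (φ : ℚ →+* ℝ) (c : Field.absoluteGaloisGroup ℚ), Literature.NumberTheory.GaloisRepresentations.IsComplexConjugation φ c → Matrix.GeneralLinearGroup.det (ρ c) = 1) → ∀ (K : Type) [Field K] [NumberField K], NumberField.IsTotallyComplex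 K → Module.finrank ℚ K = 2 → (ρ.restrictField K).toGaloisRep.IsIrreducible → ∀ m : ℕ, ∃ (hcpt : Literature.NumberTheory.Automorphic.isCompact_glFiniteIntegralLevel 2 K) (π : Literature.NumberTheory.Automorphic.CuspidalAutomorphicRepData 2 K hcpt) (r : Literature.NumberTheory.GaloisRepresentations.FramedGaloisRep K (PadicAlgCl p) 2), π.1.IsRegularAlgebraic ∧ (∀ v : IsDedekindDomain.HeightOneSpectrum (NumberField.RingOfIntegers K), (ρ.restrictField K).IsUnramifiedAt v → ((p : ℕ) : NumberField.RingOfIntegers K) ∉ v.asIdeal → π.1.IsUnramifiedAt v) ∧ (∀ᶠ v : IsDedekindDomain.HeightOneSpectrum (NumberField.RingOfIntegers K) in Filter.cofinite, ∀ α : Multiset ℂ, π.1.HasSatakeParamAt v α → r.IsUnramifiedAt v ∧ r.HasFrobCharpolyAt v (Literature.NumberTheory.Automorphic.arithFrobPolyOfSatake ι v.residueCard 2 α)) ∧ (∀ (g : Field.absoluteGaloisGroup K) (i j : Fin 2), ‖(r g).val i j - ((ρ.restrictField K) g).val i j‖ ≤ (p : ℝ) ^ (-(m : ℤ)))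

-- item stmt-Langlands-2457 · support · rank 9 · closed · moot by None · by planner — informal only, no Lean statement yet:
--   [support] SmithDescentOccurrence — R2 of the card (calibration of O_K's devissage for SOLVABLE
--   images; not load-bearing for the Assembly; informal until CompletedCohomology and a
--   Tate-cohomology/Brauer-homomorphism notion land). Let K″/K′ be cyclic of prime degree ℓ (number
--   fields over the imaginary quadratic K), σ a generator, ρ_{K′} an irreducible Artin representation of
--   Γ_{K′} with ρ_{K′}|_{Γ_{K″}} irreducible. CLAIM (descent of occurrence AT the prime ℓ = [K″:K′]): if
--   the Hecke eigensystem of ρ_{K′}|_{Γ_{K″}} occurs in H^*(Y_{K″}(K″^ℓ K″_ℓ(ℓ^s)), 𝔽̄_ℓ) for some s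
--   (resp. in ℤ/ℓ^t-cohomology

/-- item stmt-Langlands-3642 · support · rank 9 · closed · moot by None · by planner
sources: Literature.NumberTheory.Automorphic.exists_galoisRep_of_regularAlgebraic (tree, lang.S27: HarrisLanTaylorThorneRMS2016 Thm A; VarmaFMS2024 Thm 1), doi:10.1007/bf01232440 (Harris–Soudry–Taylor 1993, Invent. Math. 112), doi:10.1007/bf01231575 (Taylor 1994, Invent. Math. 116), doi:10.1093/imrn/rnm113 (Berger–Harcos 2007, IMRN), doi:10.1112/s0010437x13007665 (Mok 2014, Compositio Math. 150), planner Sketch.lean rc 0: galoisRepOfRACuspidalImQuad_of_fact, eventually_clause_of_item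
[support] Names the ONE fact among the route's 21 unproved cone facts that its items actually use:
the n = 2, K imaginary-quadratic case of
Literature.NumberTheory.Automorphic.exists_galoisRep_of_regularAlgebraic (lang.S27;
HarrisLanTaylorThorneRMS2016 Thm A + VarmaFMS2024 Thm 1; for GL₂ over imaginary quadratic K already
Harris–Soudry–Taylor 1993 doi:10.1007/bf01232440, Taylor 1994 doi:10.1007/bf01231575, Berger–Harcos
2007 doi:10.1093/imrn/rnm113, Mok 2014 doi:10.1112/s0010437x13007665), verbatim clause: for π
regular-algebraic cuspidal on GL₂(𝔸_K), every p and ι, some r : Γ_K → GL₂(ℚ̄_p) is unramified with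
charpoly(Frob_v) = arithFrobPolyOfSatake ι q_v 2 α at every v ∤ p where π has Satake parameter α.
Consumed by r5 EvenRestrictionLimit (the r_m attached to π_m beyond the dihedral case) and r6
LimitClassicality / R_K (their lang.S27 normalisation). One-line consequence of the named fact once
it is discharged (planner Sketch.lean rc 0: galoisRepOfRACuspidalImQuad_of_fact, via imaginary
quadratic ⇒ NumberField.IsCMField = Mathlib IsCMField.ofCMExtension over ℚ;
eventually_clause_of_item turns it into the ∀ᶠ-in-cofinite clause used inside r5/r6). needs-fact:
Literature.NumberTheor -/
@[route_item "route-Langlands-BianchiArtinPoints"]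
def GaloisRepOfRACuspidalImQuad : Prop :=
  ∀ (K : Type) [Field K] [NumberField K], NumberField.IsTotallyComplex K → Module.finrank ℚ K = 2 → ∀ (hcpt : Literature.NumberTheory.Automorphic.isCompact_glFiniteIntegralLevel 2 K) (π : Literature.NumberTheory.Automorphic.CuspidalAutomorphicRepData 2 K hcpt), π.1.IsRegularAlgebraic → ∀ (p : ℕ) [Fact p.Prime] (ι : PadicAlgCl p ≃+* ℂ), ∃ r : Literature.NumberTheory.GaloisRepresentations.FramedGaloisRep K (PadicAlgCl p) 2, ∀ (v : IsDedekindDomain.HeightOneSpectrum (NumberField.RingOfIntegers K)) (α : Multiset ℂ), π.1.HasSatakeParamAt v α → ((p : ℕ) : NumberField.RingOfIntegers K) ∉ v.asIdeal → r.IsUnramifiedAt v ∧ r.HasFrobCharpolyAt v (Literature.NumberTheory.Automorphic.arithFrobPolyOfSatake ι v.residueCard 2 α)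

/-- item stmt-Langlands-2304 · assembly · rank 1 · closed · moot by None · by planner
sources: planner Sketch.lean (rc 0, assembly_holds)
[assembly] StrongArtinEvenOverImQuad → QuadraticDescentEven → StrongArtinEvenQ: given ρ even
irreducible of finite image, feed the K-sector statement (all imaginary quadratic K with ρ|_K
irreducible) into the descent crux. Two-line term proof in the planner's Sketch.lean: `intro hK hD p
_ ι ρ hfin hirr heven; exact hD p ι ρ hfin hirr heven (fun K _ _ h1 h2 h3 => hK p ι ρ hfin hirr
heven K h1 h2 h3)`. Calibration item; provable now. -/
@[route_item "route-Langlands-BianchiArtinPoints"]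
def Assembly : Prop :=
  StrongArtinEvenOverImQuad → QuadraticDescentEven → StrongArtinEvenQ

end Summit.Langlands.Langlands.Theses.BianchiArtinPoints
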